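import Mathlib
import HarnessLib
import Summits.CriticalPhenomena.CardyFormulaZ2.Theses.CardyMagicRigidity
import Summits.CriticalPhenomena.CardyFormulaZ2.Theorems.CardyMagicRigidityMagicFormulaTStubDilation
import Summits.CriticalPhenomena.CardyFormulaZ2.Theorems.CardyMagicRigidityMagicFormulaTStubCellBridge
import Summits.CriticalPhenomena.CardyFormulaZ2.Theorems.CardyMagicRigidityMagicFormulaTStubRiemannLog
import Literature.Probability.Percolation.FullPlaneCNL
import Literature.Probability.Percolation.HexLatticeSegments
import Literature.Probability.RandomPlanarGeometry.NestingTransform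

/-!
# `MagicFormulaT` from the uniform dense magic formula on the unit lattice (`C⁺⁺`)

Crux stmt-CriticalPhenomena-4836, `Summit.CriticalPhenomena.CardyFormulaZ2.Theses.CardyMagicRigidity.MagicFormulaT`
(route `CardyMagicRigidity`): for every admissible density `f` (measurable, `|f| ≤ C`, `f = 0` off `‖z‖ ≤ R`,
`∫ f = 0`) the site-`𝕋` twisted nesting transform `Λ^𝕋_δ(f)` tends to `exp((3/4π²) ∬ log‖x−y‖ f(x) f(y))`
as `δ → 0⁺`.

This file is the sorry-free COMPOSITION of line `Sketch` (registered skeleton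
`Cruxes/MagicFormulaT/Lines/Sketch.lean`, v5) minus its one open stub: it proves

* `magicFormulaT_of_uniformDenseMagicT` — **the crux follows from `C⁺⁺`, the uniform dense magic formula on
  the FIXED unit lattice `𝕋`**: for all `R`, `C`, `ε > 0` there is `δ₀ > 0` such that for every `δ ∈ (0, δ₀)`
  and every finite NEUTRAL charge configuration `λ` on sites of `B̄(0, R/δ)` with `|λ_x| ≤ C δ²`, the dense
  twisted transform `E_{1/2}[∏_u 2cos(Σ_{x : W(u,x) ≠ 0} λ_x + π/3)]` (product over all interface loops of the
  full-plane configuration at mesh `1`, charges at the sites = hexagon centres `triMeshPoint 1 x`) is within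
  `ε` of the discrete free-field shape `exp((3/4π²) Σ_{x ≠ y} λ_x λ_y log‖x − y‖)`.

The hypothesis is stated in tree vocabulary only (it is, verbatim, the registered stub `stub_denseMagicT` of
the skeleton). The proof assembles the three LANDED stubs of the line:
`stub_dilation` (`Λ^𝕋_δ(f) = Λ^𝕋_1(f_δ)`, `f_δ = δ² f(δ·)`; p86072),
`stub_cellBridge` (exact Voronoi-cell bridge at mesh `1`: `Λ^𝕋_1(f_δ)` IS the dense transform of the cell
charges `λ_x = ∫_{H_x} f_δ`, with `|λ_x| ≤ 4Cδ²`, `Σ λ = 0`, sites of norm `≤ (2|R|+3)/δ`; p90564),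
`stub_riemannLog` (Riemann sums for the logarithmic energy; p93521), by a `3ε`-type argument.

Why it matters: `C⁺⁺` is the crux restated as a statement about ONE lattice, `𝕋` at mesh `1`, with no
continuum integrals inside the expectation (interiors enter only through winding numbers about SITES, never on
a trace) — the form any lattice-side mechanism (transfer matrices, couplings, exact identities) must address.
By the cell bridge read backwards, `C⁺⁺` is also NECESSARY for the crux made uniform over
`{f : |f| ≤ C′, supp f ⊆ B_{R′}, ∫ f = 0}`; it is crux-sized (all-order Gaussianity of the twisted CLE₆
nesting field) and is NOT proved here.
-/

noncomputable section

namespace Summit.CriticalPhenomena.CardyFormulaZ2.Cruxes.MagicFormulaT.LineSketch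

open MeasureTheory Filter Finset
open scoped Real Topology BigOperators
open Literature.Probability.RandomPlanarGeometry Literature.Probability.Percolation
  Literature.Probability.LatticeModels

/-- **The dense transform of the cell charges tends to the Gaussian functional, given `C⁺⁺`.** At mesh `1`,
with the cell charges `λ_x = ∫_{H_x} f_δ` of an admissible `f` on the sites of `triBall ⌈2(R/δ+1)⌉₊`:
`E[∏_u 2cos(Σ_{W(u,x)≠0} λ_x + π/3)] → exp((3/4π²) ∬ log‖x−y‖ f f)` as `δ → 0⁺` — `|dense − shape| < ε/2`
by `C⁺⁺` at radius `2|R|+3` and charge bound `4C` (hypotheses supplied by `stub_cellBridge`), and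
`shape → Gaussian` by `stub_riemannLog`. -/
theorem tendsto_denseTransform_cellCharges
    (hD : ∀ R C ε : ℝ, 0 < ε → ∃ δ₀ : ℝ, 0 < δ₀ ∧ ∀ δ ∈ Set.Ioo (0 : ℝ) δ₀,
      ∀ (S : Finset (Site 2)) (lam : Site 2 → ℝ),
        (∀ x ∈ S, ‖triMeshPoint 1 x‖ ≤ R / δ) → (∀ x ∈ S, |lam x| ≤ C * δ ^ 2) → ∑ x ∈ S, lam x = 0 →
          |(∫ cfg, (∏ᶠ u ∈ (siteLoopConfig 1 cfg).loops,
              2 * Real.cos ((∑ x ∈ S, if u.wind (triMeshPoint 1 x) ≠ 0 then lam x else 0) + π / 3))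
                ∂(triSitePercolation half)) -
            Real.exp (3 / (4 * π ^ 2) * ∑ x ∈ S, ∑ y ∈ S,
              if x = y then 0 else lam x * lam y * Real.log ‖triMeshPoint 1 x - triMeshPoint 1 y‖)| < ε)
    {f : ℂ → ℝ} {R C : ℝ} (hf : Measurable f) (hC : ∀ z, |f z| ≤ C) (hR : ∀ z, R < ‖z‖ → f z = 0)
    (h0 : ∫ z, f z = 0) :
    Tendsto (fun δ : ℝ ↦ ∫ cfg, (∏ᶠ u ∈ (siteLoopConfig 1 cfg).loops,
        2 * Real.cos ((∑ x ∈ triBall ⌈2 * (R / δ + 1)⌉₊,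
          if u.wind (triMeshPoint 1 x) ≠ 0 then
            (∫ z in {z : ℂ | ∀ i : Fin 3, |hform i (z - triMeshPoint 1 x)| < 1}, δ ^ 2 * f ((δ : ℂ) * z))
          else 0) + π / 3)) ∂(triSitePercolation half))
      (𝓝[>] 0) (𝓝 (Real.exp (3 / (4 * Real.pi ^ 2) * ∫ x, ∫ y, Real.log ‖x - y‖ * f x * f y))) := by
  -- the discrete free-field shape of the cell charges tends to the Gaussian functional (`stub_riemannLog`)
  have hexp : Continuous fun t : ℝ ↦ Real.exp (3 / (4 * π ^ 2) * t) :=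
    Real.continuous_exp.comp (continuous_const.mul continuous_id)
  have hshape := (hexp.tendsto _).comp (stub_riemannLog f R C hf hC hR h0)
  rw [Metric.tendsto_nhds] at hshape ⊢
  intro ε hε
  have hε2 : 0 < ε / 2 := half_pos hε
  -- `C⁺⁺` at radius `2|R| + 3`, charge bound `4C`, tolerance `ε/2`
  obtain ⟨δ₀, hδ₀, hδ₀'⟩ := hD (2 * |R| + 3) (4 * C) (ε / 2) hε2
  have hmem : Set.Ioo (0 : ℝ) (min δ₀ 1) ∈ 𝓝[>] (0 : ℝ) := Ioo_mem_nhdsGT (lt_min hδ₀ one_pos)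
  filter_upwards [hmem, hshape (ε / 2) hε2] with δ hδ hδshape
  have hδ0 : 0 < δ := hδ.1
  have hδ1 : δ ≤ 1 := (hδ.2.trans_le (min_le_right _ _)).le
  have hδδ₀ : δ ∈ Set.Ioo (0 : ℝ) δ₀ := ⟨hδ0, hδ.2.trans_le (min_le_left _ _)⟩
  -- the side conditions of `C⁺⁺` for the cell charges (`stub_cellBridge`, conjuncts (ii)–(iv))
  obtain ⟨-, hb, hs, hn⟩ := stub_cellBridge f R C δ hf hC hR h0 hδ0 hδ1
  have key := hδ₀' δ hδδ₀ (triBall ⌈2 * (R / δ + 1)⌉₊)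
    (fun x ↦ ∫ z in {z : ℂ | ∀ i : Fin 3, |hform i (z - triMeshPoint 1 x)| < 1}, δ ^ 2 * f ((δ : ℂ) * z))
    hn hb hs
  beta_reduce at key
  simp only [Function.comp_apply, Real.dist_eq] at hδshape
  rw [Real.dist_eq]
  -- `|dense − G| ≤ |dense − shape| + |shape − G| < ε/2 + ε/2`
  have htri := abs_sub_le
    (∫ cfg, (∏ᶠ u ∈ (siteLoopConfig 1 cfg).loops,
      2 * Real.cos ((∑ x ∈ triBall ⌈2 * (R / δ + 1)⌉₊,
        if u.wind (triMeshPoint 1 x) ≠ 0 then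
          (∫ z in {z : ℂ | ∀ i : Fin 3, |hform i (z - triMeshPoint 1 x)| < 1}, δ ^ 2 * f ((δ : ℂ) * z))
        else 0) + π / 3)) ∂(triSitePercolation half))
    (Real.exp (3 / (4 * π ^ 2) * ∑ x ∈ triBall ⌈2 * (R / δ + 1)⌉₊, ∑ y ∈ triBall ⌈2 * (R / δ + 1)⌉₊,
      if x = y then 0 else
        (∫ z in {z : ℂ | ∀ i : Fin 3, |hform i (z - triMeshPoint 1 x)| < 1}, δ ^ 2 * f ((δ : ℂ) * z)) *
        (∫ z in {z : ℂ | ∀ i : Fin 3, |hform i (z - triMeshPoint 1 y)| < 1}, δ ^ 2 * f ((δ : ℂ) * z)) *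
        Real.log ‖triMeshPoint 1 x - triMeshPoint 1 y‖))
    (Real.exp (3 / (4 * Real.pi ^ 2) * ∫ x, ∫ y, Real.log ‖x - y‖ * f x * f y))
  linarith

/-- **`MagicFormulaT` from the uniform dense magic formula `C⁺⁺` on the unit lattice** (sorry-free
composition of line `Sketch`: dilation identity `stub_dilation` + Voronoi-cell bridge `stub_cellBridge` +
Riemann sums for the logarithmic energy `stub_riemannLog`). The hypothesis is verbatim the registered stub
`stub_denseMagicT`; a proof of it closes the crux in one line. -/
theorem magicFormulaT_of_uniformDenseMagicT :
    (∀ R C ε : ℝ, 0 < ε → ∃ δ₀ : ℝ, 0 < δ₀ ∧ ∀ δ ∈ Set.Ioo (0 : ℝ) δ₀,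
      ∀ (S : Finset (Site 2)) (lam : Site 2 → ℝ),
        (∀ x ∈ S, ‖triMeshPoint 1 x‖ ≤ R / δ) → (∀ x ∈ S, |lam x| ≤ C * δ ^ 2) → ∑ x ∈ S, lam x = 0 →
          |(∫ cfg, (∏ᶠ u ∈ (siteLoopConfig 1 cfg).loops,
              2 * Real.cos ((∑ x ∈ S, if u.wind (triMeshPoint 1 x) ≠ 0 then lam x else 0) + π / 3))
                ∂(triSitePercolation half)) -
            Real.exp (3 / (4 * π ^ 2) * ∑ x ∈ S, ∑ y ∈ S,
              if x = y then 0 else lam x * lam y * Real.log ‖triMeshPoint 1 x - triMeshPoint 1 y‖)| < ε) →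
    Summit.CriticalPhenomena.CardyFormulaZ2.Theses.CardyMagicRigidity.MagicFormulaT := by
  intro hD f R C hf hC hR h0
  refine (tendsto_denseTransform_cellCharges hD hf hC hR h0).congr' ?_
  filter_upwards [Ioo_mem_nhdsGT (one_pos : (0 : ℝ) < 1)] with δ hδ
  -- `Λ^𝕋_δ(f) = Λ^𝕋_1(f_δ)` (`stub_dilation`) `=` dense transform of the cell charges (`stub_cellBridge` (i))
  exact ((stub_dilation f δ hδ.1).trans (stub_cellBridge f R C δ hf hC hR h0 hδ.1 hδ.2.le).1).symm

end Summit.CriticalPhenomena.CardyFormulaZ2.Cruxes.MagicFormulaT.LineSketch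

end
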